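import Mathlib.LinearAlgebra.Matrix.GeneralLinearGroup.Basic
import Mathlib.LinearAlgebra.Matrix.Transvection
import Literature.RepresentationTheory.FiniteGroups.SLnMinimalCharacterDegree
import Literature.RepresentationTheory.FiniteGroups.SecondOrthogonality
import Literature.RepresentationTheory.FiniteGroups.MinimalNonlinearDegreeCommutator
import HarnessLib

/-!
# The minimal degree of a non-linear irreducible character of `GL_n(𝔽_q)`
# (Landazuri–Seitz 1974, Lemma 3.1, transferred from `SL_n(𝔽_q)`)

Topic `Literature/RepresentationTheory/FiniteGroups`, namespace
`Literature.RepresentationTheory.FiniteGroups` (grouping sub-namespace `GLn` for the statements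
about the group `GL_n`).  Everything here is **proved**; no definition, no named fact.

## The printed source and what is proved

V. Landazuri, G. M. Seitz, *On the minimal degrees of projective representations of the finite
Chevalley groups*, J. Algebra 32 (1974) 418–443 [LandazuriSeitz1974], Lemma 3.1 (p. 424): the least
degree `> 1` of a (projective) irreducible representation of `PSL(n, q)` is `≥ q^{n−1} − 1` for
`n > 2` and `≥ (q − 1)/(2, q − 1)` for `n = 2`.  The tree proves this for the ordinary characters of
`SL_n(𝔽_q)` (`SLn.le_charDegree_of_three_le`, `SLn.le_charDegree_two`,
`SLn.card_le_two_mul_charDegree_add_one`, file `SLnMinimalCharacterDegree.lean`).  This file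
transfers the bound to the full linear group:

* **`GLn.le_charDegree_of_three_le`** — for `n ≥ 3`, every irreducible complex character of
  `GL_n(𝔽_q)` of degree `d > 1` has `q^{n−1} − 1 ≤ d`;
* **`GLn.le_charDegree_two`** — for `n = 2`: `q − 1 ≤ gcd(2, q − 1) · d`;
* **`GLn.card_le_two_mul_charDegree_add_one`** — the coarse `q ≤ 2d + 1` for every `n ≥ 2`
  (the form consumed by the matrix-multiplication barrier for `GL(n, q)`,
  `Literature/Barriers/MatrixMultiplication/QuasirandomBarrierGLn.lean`: "`n(GL_n(q)) ≥ q^{n−1}/4`").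

These are consequences of Lemma 3.1 and not its statement; the exact minimal non-linear degree of
`GL_n(q)` (e.g. `q − 1` for `GL_2(q)`, `q ≥ 3`; `2` for `GL_2(2) ≅ 𝔖₃`; `3` for `GL_3(2)`) is
neither needed nor claimed.
The consumer is Blasiak–Cohn–Grochow–Pratt–Umans 2023 [BlasiakCohnGrochowPrattUmans2023], §3.2,
footnote to the paragraph before Cor. 3.8 (p. 7): TPP triples "in `GL(n,q)` with fixed `n` cannot
meet the packing bound, because intersecting random translates of the subsets with `SL(n,q)` would
give subsets of `SL(n,q)` meeting the packing bound in expectation, and … `SL(n,q)` [is] a group of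
Lie type of bounded rank when `n` is fixed" — i.e. the quasirandomness of `SL(n, q)` controls
`GL(n, q)`; the present file is the character-theoretic form of that transfer.

## The argument (Clifford theory with the commutator subgroup; Isaacs Ch. 2, Ch. 6)

`exists_charDegree_le_of_commutator` — for a homomorphism `f : A → B` of finite groups with `B' ≤ f(A)` and
`A` perfect, a lower bound `b` for the non-linear irreducible degrees of `A` is one for `B`:
given `χ ∈ Irr(B)` with `χ(1) > 1`, the pull-back `χ ∘ f` is a character of `A`
(`IsCharacter.comp`); if one of its irreducible constituents `ψ` is non-linear then
`b ≤ ψ(1) ≤ χ(1)` (`IsCharacter.exists_eq_add_of_classInner_ne_zero`); otherwise every constituent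
is linear, so `χ ∘ f` is constant on `A' = A` (`apply_eq_apply_one_of_constituents_linear`), i.e.
`f(A) ⊆ ker χ`, and `χ` deflates to an irreducible character of the abelian group `B/f(A)`
(`IsIrrChar.exists_quotient`), which is linear (Serre Thm. 9, `Serre1977_thm9_holds`) —
contradicting `χ(1) > 1`.  Applied to `toGL : SL_n(F) → GL_n(F)`: `GL_n(F)' ≤ ker det = SL_n(F)`
(`Abelianization.commutator_subset_ker`) and `SL_n(F)` is perfect for `n ≥ 3` or `|F| ≥ 4`
(the tree's `SLn.commutator_eq_top_of_four_le_card`); the two exceptions `GL_2(𝔽_2)`, `GL_2(𝔽_3)`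
of the coarse bound are settled by `q ≤ 3 < 2d + 1`.

## Mathlib / tree search

Mathlib: `Matrix.SpecialLinearGroup.toGL`, `Matrix.GeneralLinearGroup.det`,
`Matrix.GeneralLinearGroup.center_eq_range_scalar`, `Matrix.transvection`,
`Abelianization.commutator_subset_ker`, `Subgroup.Normal.quotient_commutative_iff_commutator_le`;
no character degrees of `GL_n(q)` beyond the tree.  Tree (`lean search`/`rg`): Green's UPPER bound
`GreenGLnDegreeBound_holds` (`χ(1) ≤ 2ⁿ p^{n(n−1)/2}`), `GLn.exists_irrChar_card_le_sq` (a LARGE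
degree), the `SL_n` lower bounds above; no lower bound for `GL_n` (this file).

## References

* [LandazuriSeitz1974] V. Landazuri, G. M. Seitz, J. Algebra 32 (1974) 418–443, Lemma 3.1.
* [Isaacs1976] I. M. Isaacs, *Character Theory of Finite Groups*, Lemma 2.22, Cor. 2.23, Thm. 6.2.
* [BlasiakCohnGrochowPrattUmans2023] J. Blasiak, H. Cohn, J. A. Grochow, K. Pratt, C. Umans,
  *Matrix multiplication via matrix groups*, ITCS 2023 = arXiv:2204.03826, §3.2 (footnote, p. 7).
-/

noncomputable section

open scoped BigOperators commutatorElement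
open Matrix

namespace Literature.RepresentationTheory.FiniteGroups

/-! ## §1 Transfer of a minimal-degree bound along `f : A → B` with `B' ≤ f(A)`, `A` perfect -/

section Transfer

variable {A B : Type} [Group A] [Group B] [Fintype A] [Fintype B]

omit [Fintype B] in
/-- A subgroup containing the commutator subgroup is normal (`g n g⁻¹ = [g, n] · n`). [folklore] -/
private theorem normal_of_commutator_le {N : Subgroup B} (hN : commutator B ≤ N) : N.Normal := by
  refine ⟨fun n hn g => ?_⟩
  have hc : ⁅g, n⁆ ∈ commutator B :=
    Subgroup.commutator_mem_commutator (Subgroup.mem_top g) (Subgroup.mem_top n)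
  have h := N.mul_mem (hN hc) hn
  rwa [commutatorElement_def, inv_mul_cancel_right] at h

/-- An irreducible character of a finite group whose kernel contains a subgroup `N ⊇ B'` is linear
(it is inflated from the abelian group `B/N`: Isaacs Lemma 2.22 with Serre's Thm. 9).
[cite: Isaacs1976, Lemma 2.22 and Cor. 2.23] -/
theorem IsIrrChar.apply_one_eq_one_of_commutator_le {N : Subgroup B} (hN : commutator B ≤ N)
    {χ : B → ℂ} (hχ : IsIrrChar B χ) (hker : ∀ n ∈ N, χ n = χ 1) : χ 1 = 1 := by
  haveI : N.Normal := normal_of_commutator_le hN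
  obtain ⟨χ', hχ', hcomp⟩ := hχ.exists_quotient N hker
  have hcomm : ∀ a b : B ⧸ N, a * b = b * a := fun a b =>
    (Subgroup.Normal.quotient_commutative_iff_commutator_le.mpr hN : IsMulCommutative (B ⧸ N)).is_comm.comm a b
  obtain ⟨W, _, _, _, σ, hσ, hσχ⟩ := hχ'
  have hdeg := (Serre1977_thm9_holds (B ⧸ N)).mp hcomm (Module.finrank ℂ W) ⟨W, _, _, ‹_›, σ, hσ, rfl⟩
  have h1 : χ' 1 = 1 := by rw [← hσχ, σ.char_one, hdeg, Nat.cast_one]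
  rw [← hcomp, Function.comp_apply, QuotientGroup.mk_one, h1]

/-- **Transfer of a minimal-degree bound.**  Let `f : A → B` be a homomorphism of finite groups
with `B' ≤ f(A)` and `A' = A`.  Then below every irreducible character degree `d > 1` of `B` there
is an irreducible character degree `d' > 1` of `A` with `d' ≤ d` (restrict to `A` and take a
non-linear constituent — one exists, for otherwise the character deflates to the abelian quotient
`B/f(A)` and is linear); so any lower bound for the non-linear degrees of `A` is one for `B`.
[cite: Isaacs1976, Lemma 2.22, Cor. 2.23 and Thm. 6.2] -/
theorem exists_charDegree_le_of_commutator (f : A →* B) (hB : commutator B ≤ f.range)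
    (hA : commutator A = ⊤) {d : ℕ} (hd : d ∈ charDegrees B) (h1 : 1 < d) :
    ∃ d' ∈ charDegrees A, 1 < d' ∧ d' ≤ d := by
  classical
  obtain ⟨χ, hχ, hχd⟩ := exists_isIrrChar_of_mem_charDegrees hd
  have hπ : IsCharacter A (χ ∘ f) := hχ.isCharacter.comp f
  have hπ1 : (χ ∘ f) 1 = χ 1 := by rw [Function.comp_apply, map_one]
  by_cases hlin : ∀ ψ : A → ℂ, IsIrrChar A ψ → classInner (χ ∘ f) ψ ≠ 0 → ψ 1 = 1
  · -- every constituent of `χ ∘ f` is linear: `χ` is trivial on `f(A) ⊇ B'`, hence linear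
    exfalso
    have hconst : ∀ a : A, (χ ∘ f) a = (χ ∘ f) 1 := fun a =>
      apply_eq_apply_one_of_constituents_linear hπ hlin (hA ▸ Subgroup.mem_top a)
    have hker : ∀ n ∈ f.range, χ n = χ 1 := by
      rintro n ⟨a, rfl⟩
      have := hconst a
      rwa [hπ1] at this
    have h11 := hχ.apply_one_eq_one_of_commutator_le hB hker
    rw [hχd, Nat.cast_eq_one] at h11
    omega
  · push Not at hlin
    obtain ⟨ψ, hψ, hne, hψ1⟩ := hlin
    obtain ⟨d', hd', hψd'⟩ := hψ.exists_apply_one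
    have hd'1 : 1 < d' := by
      have h0 := pos_of_mem_charDegrees hd'
      have hne1 : d' ≠ 1 := fun h => hψ1 (by rw [hψd', h, Nat.cast_one])
      omega
    obtain ⟨ξ, hξ, hsum⟩ := hπ.exists_eq_add_of_classInner_ne_zero hψ hne
    obtain ⟨nξ, hnξ⟩ := hξ.exists_nat_apply_one
    have hdd : (d : ℂ) = d' + nξ := by
      rw [← hχd, ← hψd', ← hnξ, ← hπ1, hsum, Pi.add_apply]
    have hdd' : d = d' + nξ := by exact_mod_cast hdd
    exact ⟨d', hd', hd'1, by omega⟩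

end Transfer

/-! ## §2 `GL_n(F)`: the commutator subgroup lies in `SL_n(F)`, and `GL_n(F)` is non-abelian -/

namespace GLn

variable {F : Type} [Field F] {m : ℕ}

/-- `GL_n(F)' ≤ SL_n(F)` (the image of `toGL`): commutators have determinant `1`
(`det : GL_n(F) → F^×` has abelian target). [folklore] -/
private theorem commutator_le_range_toGL {ι : Type} [Fintype ι] [DecidableEq ι] :
    commutator (GL ι F) ≤ (SpecialLinearGroup.toGL : SpecialLinearGroup ι F →* GL ι F).range := by
  intro g hg
  have hdet : g ∈ (GeneralLinearGroup.det : GL ι F →* Fˣ).ker :=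
    Abelianization.commutator_subset_ker _ hg
  rw [MonoidHom.mem_ker] at hdet
  have hdet' : Matrix.det ((g : GL ι F) : Matrix ι ι F) = 1 := by
    have h := congrArg Units.val hdet
    rwa [GeneralLinearGroup.val_det_apply] at h
  exact ⟨⟨(g : Matrix ι ι F), hdet'⟩, Units.ext rfl⟩

/-- `GL_{m+1}(F)` is non-abelian for `m ≥ 1` (the "finite nonabelian group" hypothesis of
BCGPU Def. 3.1 / Thm. 3.2 for the groups `GL(n, q)` of §3.2): the transvection `1 + E_{0,last}` is
not a scalar matrix, while the centre of `GL` consists of the scalars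
(`Matrix.GeneralLinearGroup.center_eq_range_scalar`).
[cite: BlasiakCohnGrochowPrattUmans2023, Def. 3.1 and §3.2 (paragraph before Cor. 3.8)] -/
theorem exists_not_commute (hm : 1 ≤ m) : ∃ a b : GL (Fin (m + 1)) F, a * b ≠ b * a := by
  classical
  by_contra h
  push Not at h
  have h0l : (0 : Fin (m + 1)) ≠ Fin.last m := by
    intro h0
    have := congrArg Fin.val h0
    simp at this
    omega
  set t : GL (Fin (m + 1)) F :=
    SpecialLinearGroup.toGL ⟨transvection (0 : Fin (m + 1)) (Fin.last m) (1 : F),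
      det_transvection_of_ne _ _ h0l 1⟩ with ht
  have hcen : t ∈ Subgroup.center (GL (Fin (m + 1)) F) :=
    Subgroup.mem_center_iff.mpr fun g => h g t
  rw [GeneralLinearGroup.center_eq_range_scalar] at hcen
  obtain ⟨u, hu⟩ := hcen
  have hval : ((GeneralLinearGroup.scalar (Fin (m + 1)) u : GL (Fin (m + 1)) F) :
      Matrix (Fin (m + 1)) (Fin (m + 1)) F) 0 (Fin.last m) =
      (transvection (0 : Fin (m + 1)) (Fin.last m) (1 : F)) 0 (Fin.last m) := by
    rw [hu]; rfl
  rw [GeneralLinearGroup.coe_scalar, scalar_apply, diagonal_apply_ne _ h0l, transvection,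
    Matrix.add_apply, one_apply_ne h0l, single_apply_same, zero_add] at hval
  exact zero_ne_one hval

variable [Fintype F] [DecidableEq F]

/-- **Landazuri–Seitz for `GL_n(𝔽_q)`, `n ≥ 3`**: every irreducible complex character of
`GL_n(F)`, `n = m + 1 ≥ 3`, `F` a finite field with `q` elements, of degree `d > 1` has
`d ≥ q^{n−1} − 1` (transfer of Lemma 3.1 for `SL_n(F)` along `SL_n(F) ≤ GL_n(F) ⊇ GL_n(F)'`,
`SL_n(F)` perfect for `n ≥ 3`). [cite: LandazuriSeitz1974, Lemma 3.1] -/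
theorem le_charDegree_of_three_le (hm : 2 ≤ m) {d : ℕ}
    (hd : d ∈ charDegrees (GL (Fin (m + 1)) F)) (h1 : 1 < d) :
    Fintype.card F ^ m - 1 ≤ d := by
  haveI : Nontrivial (Fin (m + 1)) := Fin.nontrivial_iff_two_le.mpr (by omega)
  obtain ⟨d', hd', h1', hle⟩ := exists_charDegree_le_of_commutator (SpecialLinearGroup.toGL)
    commutator_le_range_toGL
    (Literature.LinearAlgebra.Matrix.SLn.commutator_eq_top_of_four_le_card (Or.inl (by simp; omega))) hd h1
  exact (SLn.le_charDegree_of_three_le hm hd' h1').trans hle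

/-- **Landazuri–Seitz for `GL_2(𝔽_q)`**: every irreducible complex character of `GL_2(F)` of degree
`d > 1` has `q − 1 ≤ gcd(2, q − 1) · d` (transfer of Lemma 3.1 for `SL_2(F)`, perfect for
`|F| ≥ 4`; for `|F| ≤ 3` the bound reads `q − 1 ≤ 2 ≤ 2d` and holds trivially).
[cite: LandazuriSeitz1974, Lemma 3.1] -/
theorem le_charDegree_two {d : ℕ} (hd : d ∈ charDegrees (GL (Fin 2) F)) (h1 : 1 < d) :
    Fintype.card F - 1 ≤ Nat.gcd 2 (Fintype.card F - 1) * d := by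
  by_cases hF : 4 ≤ Nat.card F
  · obtain ⟨d', hd', h1', hle⟩ := exists_charDegree_le_of_commutator (SpecialLinearGroup.toGL)
      commutator_le_range_toGL
      (Literature.LinearAlgebra.Matrix.SLn.commutator_eq_top_of_four_le_card (Or.inr hF)) hd h1
    exact (SLn.le_charDegree_two hd' h1').trans (Nat.mul_le_mul_left _ hle)
  · rw [Nat.card_eq_fintype_card] at hF
    have hq : 1 < Fintype.card F := Fintype.one_lt_card
    have hg : Nat.gcd 2 (Fintype.card F - 1) = Fintype.card F - 1 := by
      interval_cases (Fintype.card F) <;> rfl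
    rw [hg]
    exact Nat.le_mul_of_pos_right _ (by omega)

/-- The coarse form `q ≤ 2d + 1` (i.e. `d ≥ (q − 1)/2`) valid for EVERY `n ≥ 2` and every character
degree `d > 1` of `GL_n(𝔽_q)` — the form consumed by the matrix-multiplication barrier for `GL(n, q)`
(`n(GL_n(q)) ≥ (q − 1)/2`, and `≥ q^{n−1} − 1` for `n ≥ 3`). [cite: LandazuriSeitz1974, Lemma 3.1] -/
theorem card_le_two_mul_charDegree_add_one (hm : 1 ≤ m) {d : ℕ}
    (hd : d ∈ charDegrees (GL (Fin (m + 1)) F)) (h1 : 1 < d) :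
    Fintype.card F ≤ 2 * d + 1 := by
  have hq : 1 < Fintype.card F := Fintype.one_lt_card
  rcases Nat.lt_or_ge m 2 with hlt | hge
  · obtain rfl : m = 1 := by omega
    have h := le_charDegree_two hd h1
    have hg : Nat.gcd 2 (Fintype.card F - 1) ≤ 2 := Nat.gcd_le_left _ two_pos
    have := Nat.mul_le_mul_right d hg
    omega
  · have h := le_charDegree_of_three_le hge hd h1
    have hpow : Fintype.card F ≤ Fintype.card F ^ m := by
      calc Fintype.card F = Fintype.card F ^ 1 := (pow_one _).symm
        _ ≤ Fintype.card F ^ m := Nat.pow_le_pow_right (by omega) (by omega)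
    omega

end GLn

end Literature.RepresentationTheory.FiniteGroups

end
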